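import Literature.NumberTheory.PAdicHodge.HodgeTatePeriodRingData
import Literature.NumberTheory.GaloisRepresentations.LabelledHodgeTateWeights
import HarnessLib

/-!
# The cyclotomic character is Hodge–Tate of weight `-1`

Continuation of `HodgeTatePeriodRingData` (`hodgeTatePeriodRingData hp : PeriodRingData Γ_F ℚ_p F`,
Fontaine's `B_HT(F) = ℂ_F[T;T⁻¹]`). We run the tree's `p`-adic Hodge-theory interface
(`PeriodRingData.D`, `IsAdmissible`, `filD`, `hodgeTateWeights` of
`Literature/NumberTheory/GaloisRepresentations/PAdicHodge.lean`) on the first genuine example: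

* `cyclotomicRepQp F p` — `ℚ_p(1)`, the cyclotomic character as a continuous rank-one
  `ℚ_p`-linear representation of `Γ_F`;
* `isAdmissible_hodgeTate_cyclotomicRepQp` — **`ℚ_p(1)` is `B_HT`-admissible** (Hodge–Tate):
  `dim_F (B_HT ⊗_{ℚ_p} ℚ_p(1))^{Γ_F} = 1`, for the canonical `ℚ_p`-structure
  `LocalField.padicAlgebra F p hp` of `F`;
* `hodgeTateWeights_cyclotomicRepQp` — **its Hodge–Tate weight is `-1`**:
  `(hodgeTatePeriodRingData hp).hodgeTateWeights (cyclotomicRepQp F p) = {-1}` (the convention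
  fixed in `PAdicHodge.lean`, Buzzard–Gee 2014 §2.2: the cyclotomic character has weight `-1`).

Proof: under `B_HT ⊗_{ℚ_p} ℚ_p ≅ B_HT` the diagonal action becomes `b ↦ χ(σ) σ(b)`
(`HT.ridHT_htRep`), whose invariants are `F · T⁻¹` (`HT.Dtw_eq_span`: the coefficient `b_n` of an
invariant lies in `ℂ_F(χ^{n+1})^{Γ_F}`, which is `0` for `n ≠ -1` by Tate's theorem and `F` for
`n = -1` by Ax–Sen–Tate); and `T⁻¹ ∈ Fil^i B_HT` iff `i ≤ -1`, so `dim Fil^i D` drops from `1` to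
`0` exactly at `i = -1` (`HT.finrank_htFilD_eq`, tree `jumpMultiset_step`).

## References

* J.-M. Fontaine, Y. Ouyang, *Theory of p-adic Galois representations*, §5.1 (Hodge–Tate
  representations; `ℚ_p(1)` is Hodge–Tate of weight `-1`/`1` according to convention). [FontaineOuyang2022]
* J. Tate, *p-divisible groups* (1967), §3.3 Theorem 2. [Tate1967]
* K. Buzzard, T. Gee, *The conjectural connections …* (2014), §2.2 (sign convention). [BuzzardGee2014]
* J.-M. Fontaine, Astérisque 223 (1994), Exp. III §1.3–1.5 (`D_B`, admissibility). [FontaineAsterisque223III]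
-/

noncomputable section

open ValuativeRel Field UniformSpace LaurentPolynomial

namespace Literature.NumberTheory.PAdicHodge

open Literature.NumberTheory.GaloisRepresentations
open Literature.NumberTheory.GaloisRepresentations.IsNonarchimedeanLocalField

variable {F : Type} [Field F] [ValuativeRel F] [TopologicalSpace F] [IsNonarchimedeanLocalField F]
  {p : ℕ} [CharZero F] [Fact p.Prime]

section CyclotomicRep

variable (F p)

omit [ValuativeRel F] [TopologicalSpace F] [IsNonarchimedeanLocalField F] [CharZero F] in
/-- The scalar `χ_F(σ) ∈ ℚ_p` depends continuously on `σ`. [folklore] -/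
theorem continuous_cyclotomicCharacter_coe :
    Continuous fun σ : absoluteGaloisGroup F =>
      (((GaloisRep.cyclotomicCharacter F p σ : ℤ_[p]ˣ) : ℤ_[p]) : ℚ_[p]) :=
  by
    have h1 : Continuous (fun u : ℤ_[p]ˣ => (u : ℤ_[p])) := Units.continuous_val
    have h2 : Continuous ((↑) : ℤ_[p] → ℚ_[p]) := continuous_subtype_val
    exact h2.comp (h1.comp (GaloisRep.cyclotomicCharacter F p).continuous)

/-- **`ℚ_p(1)`**: the cyclotomic character as a continuous rank-one `ℚ_p`-linear representation of
`Γ_F` on `M = ℚ_p` (`σ ↦` multiplication by `χ_F(σ)`). [cite: Tate1967, §3.3] -/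
def cyclotomicRepQp : ContinuousRep (absoluteGaloisGroup F) ℚ_[p] ℚ_[p] where
  toRepresentation :=
    { toFun := fun σ =>
        (((GaloisRep.cyclotomicCharacter F p σ : ℤ_[p]ˣ) : ℤ_[p]) : ℚ_[p]) • (LinearMap.id : ℚ_[p] →ₗ[ℚ_[p]] ℚ_[p])
      map_one' := by rw [map_one, Units.val_one, PadicInt.coe_one, one_smul]; rfl
      map_mul' := fun σ τ => by
        rw [map_mul, Units.val_mul, PadicInt.coe_mul, mul_smul]
        refine LinearMap.ext fun v => ?_
        simp only [LinearMap.smul_apply, LinearMap.id_apply, Module.End.mul_apply, smul_eq_mul] }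
  continuous_smul := by
    change Continuous fun q : absoluteGaloisGroup F × ℚ_[p] =>
      ((((GaloisRep.cyclotomicCharacter F p q.1 : ℤ_[p]ˣ) : ℤ_[p]) : ℚ_[p]) • (LinearMap.id : ℚ_[p] →ₗ[ℚ_[p]] ℚ_[p])) q.2
    simp only [LinearMap.smul_apply, LinearMap.id_apply]
    exact ((continuous_cyclotomicCharacter_coe F p).comp continuous_fst).smul continuous_snd

omit [ValuativeRel F] [TopologicalSpace F] [IsNonarchimedeanLocalField F] [CharZero F] in
/-- `ℚ_p(1)` acts by `χ_F(σ)`. [folklore] -/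
theorem cyclotomicRepQp_apply (σ : absoluteGaloisGroup F) (v : ℚ_[p]) :
    cyclotomicRepQp F p σ v = (((GaloisRep.cyclotomicCharacter F p σ : ℤ_[p]ˣ) : ℤ_[p]) : ℚ_[p]) * v := rfl

end CyclotomicRep

section HodgeTateCyclotomic

open scoped TensorProduct

variable (hp : valuation F p < 1) [Algebra ℚ_[p] F]

namespace HT

/-- The `F`-action commutes with `Γ_F` (symmetric form). [folklore] -/
instance instSMulCommClass' : SMulCommClass F (absoluteGaloisGroup F) (HT hp) := SMulCommClass.symm _ _ _

/-- `B_HT` as a `ℚ_p`-algebra through `ℚ_p → F → B_HT` (the structure used by `PeriodRingData`). [folklore] -/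
instance instAlgebraQp : Algebra ℚ_[p] (HT hp) :=
  ((algebraMap F (HT hp)).comp (algebraMap ℚ_[p] F)).toAlgebra

/-- `ℚ_p → F → B_HT` is a scalar tower. [folklore] -/
instance instIsScalarTowerQp : IsScalarTower ℚ_[p] F (HT hp) :=
  IsScalarTower.of_algebraMap_eq fun _ => rfl

/-- The `Γ_F`-action is `ℚ_p`-linear. [folklore] -/
instance instSMulCommClassQp : SMulCommClass (absoluteGaloisGroup F) ℚ_[p] (HT hp) where
  smul_comm σ c b := by
    rw [← algebraMap_smul (A := F) c b, smul_comm σ, algebraMap_smul]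

/-- `σ` fixes the image of `ℚ_p`. [folklore] -/
theorem smul_algebraMap_padic (σ : absoluteGaloisGroup F) (c : ℚ_[p]) :
    σ • algebraMap ℚ_[p] (HT hp) c = algebraMap ℚ_[p] (HT hp) c := by
  rw [IsScalarTower.algebraMap_apply ℚ_[p] F (HT hp), smul_algebraMap]

/-- The scalar by which `σ` acts on `ℚ_p(1)`, seen in `B_HT` (through `ℚ_p → F → B_HT`). [folklore] -/
def chiB (σ : absoluteGaloisGroup F) : HT hp :=
  algebraMap ℚ_[p] (HT hp) (((GaloisRep.cyclotomicCharacter F p σ : ℤ_[p]ˣ) : ℤ_[p]) : ℚ_[p])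

/-- **The twisted action `b ↦ χ(σ) σ(b)`** on `B_HT` (the diagonal action on `B_HT ⊗ ℚ_p(1)`
transported to `B_HT`). [cite: FontaineOuyang2022, §5.1] -/
def twisted (σ : absoluteGaloisGroup F) (b : HT hp) : HT hp := chiB hp σ * σ • b

/-- **The diagonal representation `σ ⊗ χ(σ)` on `B_HT ⊗_{ℚ_p} ℚ_p(1)`** (the formula of
`PeriodRingData.tensorRep`, on the nose). [cite: FontaineAsterisque223III, Exp. III §1.3] -/
def htRep : Representation F (absoluteGaloisGroup F) (HT hp ⊗[ℚ_[p]] ℚ_[p]) where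
  toFun σ := TensorProduct.AlgebraTensorModule.map (DistribMulAction.toModuleEnd F (HT hp) σ)
    (cyclotomicRepQp F p σ)
  map_one' := by
    rw [map_one, map_one]
    exact TensorProduct.AlgebraTensorModule.map_one
  map_mul' σ τ := by
    rw [map_mul, map_mul]
    exact TensorProduct.AlgebraTensorModule.map_mul _ _ _ _

/-- Unfolding of `htRep` on pure tensors. [folklore] -/
theorem htRep_tmul (σ : absoluteGaloisGroup F) (b : HT hp) (c : ℚ_[p]) :
    htRep hp σ (b ⊗ₜ c) = (σ • b) ⊗ₜ (cyclotomicRepQp F p σ c) := rfl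

/-- The identification `B_HT ⊗_{ℚ_p} ℚ_p ≅ B_HT` (`F`-linear). [folklore] -/
def ridHT : HT hp ⊗[ℚ_[p]] ℚ_[p] ≃ₗ[F] HT hp := TensorProduct.AlgebraTensorModule.rid ℚ_[p] F (HT hp)

omit [CharZero F] in
/-- Unfolding of `ridHT` on pure tensors. [folklore] -/
theorem ridHT_tmul (b : HT hp) (c : ℚ_[p]) : ridHT hp (b ⊗ₜ c) = c • b := rfl

/-- **Transport of the diagonal action**: under `B_HT ⊗ ℚ_p(1) ≅ B_HT`, `σ ⊗ χ(σ)` becomes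
`b ↦ χ(σ) σ(b)`. [cite: FontaineOuyang2022, §5.1] -/
theorem ridHT_htRep (σ : absoluteGaloisGroup F) (x : HT hp ⊗[ℚ_[p]] ℚ_[p]) :
    ridHT hp (htRep hp σ x) = twisted hp σ (ridHT hp x) := by
  induction x using TensorProduct.induction_on with
  | zero => rw [map_zero, map_zero, twisted, smul_zero, mul_zero]
  | tmul b c =>
    rw [htRep_tmul, cyclotomicRepQp_apply, ridHT_tmul, ridHT_tmul, twisted, mul_smul, Algebra.smul_def,
      Algebra.smul_def, Algebra.smul_def, chiB, smul_mul', smul_algebraMap_padic]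
  | add x y hx hy => rw [map_add, map_add, hx, hy, twisted, twisted, twisted, map_add, smul_add, mul_add]

/-- **`D_HT(ℚ_p(1))` transported to `B_HT`**: `{b | χ(σ) σ(b) = b for all σ}`, an `F`-submodule. [folklore] -/
def Dtw : Submodule F (HT hp) where
  carrier := {b | ∀ σ : absoluteGaloisGroup F, twisted hp σ b = b}
  zero_mem' := fun σ => by rw [twisted, smul_zero, mul_zero]
  add_mem' := by
    intro a b ha hb σ
    rw [twisted, smul_add, mul_add, ← twisted, ← twisted, ha σ, hb σ]
  smul_mem' := by
    intro e b hb σ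
    change twisted hp σ (e • b) = e • b
    rw [twisted, smul_comm σ e b, mul_smul_comm, ← twisted, hb σ]

/-- Membership in `Dtw`. [folklore] -/
theorem mem_Dtw_iff {b : HT hp} : b ∈ Dtw hp ↔ ∀ σ : absoluteGaloisGroup F, twisted hp σ b = b := Iff.rfl

/-- The invariants of `htRep` correspond to `Dtw` under `ridHT`. [folklore] -/
theorem map_invariants_eq_Dtw :
    (htRep hp).invariants.map (ridHT hp).toLinearMap = Dtw hp := by
  ext b
  constructor
  · rintro ⟨x, hx, rfl⟩ σ
    rw [LinearEquiv.coe_coe, ← ridHT_htRep, (Representation.mem_invariants _ x).mp hx σ]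
  · intro hb
    refine ⟨(ridHT hp).symm b, ?_, by simp⟩
    rw [SetLike.mem_coe, Representation.mem_invariants]
    intro σ
    apply (ridHT hp).injective
    rw [ridHT_htRep, LinearEquiv.apply_symm_apply, hb σ]

/-! ### Computation of `Dtw` for the canonical `ℚ_p`-structure -/

section Canonical

variable (halg : ∀ c : ℚ_[p], algebraMap ℚ_[p] F c = LocalField.padicRingHom F p hp c)
include halg

/-- For the canonical `ℚ_p`-structure, `χ(σ) ∈ B_HT` is the monomial `twist σ · T⁰`. [folklore] -/
theorem chiB_eq (σ : absoluteGaloisGroup F) : chiB hp σ = mono hp (twist hp σ) 0 := by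
  rw [chiB, IsScalarTower.algebraMap_apply ℚ_[p] F (HT hp), halg, algebraMap_eq, twist_def]

/-- Coefficients of the twisted action: `(χ(σ) σ b)_n = χ(σ)^{n+1} σ(b_n)`. [folklore] -/
theorem coeff_twisted (σ : absoluteGaloisGroup F) (b : HT hp) (n : ℤ) :
    coeff hp (twisted hp σ b) n = twist hp σ ^ (n + 1) * σ • coeff hp b n := by
  rw [twisted, chiB_eq hp halg, coeff_mono_zero_mul, coeff_smul, zpow_add_one₀ (twist_ne_zero hp σ)]
  ring

/-- `T⁻¹` is invariant under the twisted action (`χ(σ) · σ(T⁻¹) = χ(σ) χ(σ)⁻¹ T⁻¹`). [folklore] -/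
theorem twisted_mono_neg_one (σ : absoluteGaloisGroup F) : twisted hp σ (mono hp 1 (-1)) = mono hp 1 (-1) := by
  rw [twisted, chiB_eq hp halg, smul_mono, smul_one, one_mul, mono_mul_mono, zero_add, zpow_neg_one,
    mul_inv_cancel₀ (twist_ne_zero hp σ)]

omit [CharZero F] [Fact p.Prime] [Algebra ℚ_[p] F] halg in
/-- `c Tⁿ ≠ 0` for `c ≠ 0`. [folklore] -/
theorem mono_ne_zero {c : CompletedAlgClosure F} (hc : c ≠ 0) (n : ℤ) : mono hp c n ≠ 0 := by
  intro h
  have := congrArg (fun f => coeff hp f n) h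
  simp only [coeff_mono, coeff_zero, if_true] at this
  exact hc this

/-- **`D_HT(ℚ_p(1)) = F · T⁻¹`** (inside `B_HT`): the coefficients `b_n`, `n ≠ -1`, of an invariant
element lie in `ℂ_F(χ^{n+1})^{Γ_F} = 0` (Tate), and `b_{-1} ∈ ℂ_F^{Γ_F} = F` (Ax–Sen–Tate).
[cite: Tate1967, §3.3 Theorem 2] [cite: FontaineOuyang2022, §5.1] -/
theorem Dtw_eq_span : Dtw hp = F ∙ mono hp 1 (-1) := by
  apply le_antisymm
  · intro b hb
    have hcoeff : ∀ (σ : absoluteGaloisGroup F) (n : ℤ), twist hp σ ^ (n + 1) * σ • coeff hp b n = coeff hp b n :=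
      fun σ n => by rw [← coeff_twisted hp halg, hb σ]
    have hzero : ∀ n : ℤ, n ≠ -1 → coeff hp b n = 0 := by
      intro n hn
      refine eq_zero_of_smul_eq_twist_zpow_mul hp (j := -(n + 1)) (by omega) fun σ => ?_
      have ht := twist_ne_zero hp σ
      rw [zpow_neg, eq_inv_mul_iff_mul_eq₀ (zpow_ne_zero _ ht)]
      exact hcoeff σ n
    have hfix : coeff hp b (-1) ∈ {y : CompletedAlgClosure F | ∀ σ : absoluteGaloisGroup F, σ • y = y} := by
      intro σ
      have := hcoeff σ (-1)
      rwa [show (-1 : ℤ) + 1 = 0 by norm_num, zpow_zero, one_mul] at this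
    rw [CompletedAlgClosure.fixedPoints_eq_range_algebraMap] at hfix
    obtain ⟨e, he⟩ := hfix
    rw [Submodule.mem_span_singleton]
    refine ⟨e, ext hp fun n => ?_⟩
    rw [coeff_base_smul, coeff_mono]
    split_ifs with h
    · rw [← h, ← he, mul_one]
    · rw [mul_zero, hzero n (Ne.symm h)]
  · rw [Submodule.span_le, Set.singleton_subset_iff]
    exact fun σ => twisted_mono_neg_one hp halg σ

/-- `dim_F D_HT(ℚ_p(1)) = 1`. [cite: FontaineOuyang2022, §5.1] -/
theorem finrank_Dtw : Module.finrank F (Dtw hp) = 1 := by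
  rw [Dtw_eq_span hp halg]
  exact finrank_span_singleton (mono_ne_zero hp one_ne_zero (-1))

/-- `dim_F (B_HT ⊗ ℚ_p(1))^{Γ_F} = 1`. [cite: FontaineOuyang2022, §5.1] -/
theorem finrank_invariants : Module.finrank F (htRep hp).invariants = 1 := by
  rw [((ridHT hp).submoduleMap (htRep hp).invariants).finrank_eq]
  have h : ((htRep hp).invariants.map ((ridHT hp) : HT hp ⊗[ℚ_[p]] ℚ_[p] →ₗ[F] HT hp)) = Dtw hp :=
    map_invariants_eq_Dtw hp
  rw [h]
  exact finrank_Dtw hp halg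

end Canonical

/-! ### The filtration on `D_HT(ℚ_p(1))` -/

/-- `Fil^i B_HT ⊗ ℚ_p(1) ⊆ B_HT ⊗ ℚ_p` (the formula of `PeriodRingData.filTensor`). [folklore] -/
def htFilTensor (i : ℤ) : Submodule F (HT hp ⊗[ℚ_[p]] ℚ_[p]) :=
  LinearMap.range (TensorProduct.AlgebraTensorModule.map (fil hp i).subtype (LinearMap.id : ℚ_[p] →ₗ[ℚ_[p]] ℚ_[p]))

/-- `Fil^i D` (the formula of `PeriodRingData.filD`). [folklore] -/
def htFilD (i : ℤ) : Submodule F (htRep hp).invariants :=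
  (htFilTensor hp i).comap (htRep hp).invariants.subtype

omit [CharZero F] in
/-- Under `B_HT ⊗ ℚ_p ≅ B_HT`, `Fil^i B_HT ⊗ ℚ_p` is `Fil^i B_HT`. [folklore] -/
theorem map_htFilTensor (i : ℤ) :
    (htFilTensor hp i).map ((ridHT hp) : HT hp ⊗[ℚ_[p]] ℚ_[p] →ₗ[F] HT hp) = fil hp i := by
  apply le_antisymm
  · rintro _ ⟨x, ⟨y, rfl⟩, rfl⟩
    rw [LinearEquiv.coe_coe]
    induction y using TensorProduct.induction_on with
    | zero => rw [map_zero, map_zero]; exact zero_mem _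
    | tmul f c =>
      rw [TensorProduct.AlgebraTensorModule.map_tmul, Submodule.subtype_apply, LinearMap.id_apply,
        ridHT_tmul, ← algebraMap_smul F c (f : HT hp)]
      exact Submodule.smul_mem _ _ f.2
    | add x y hx hy => rw [map_add, map_add]; exact add_mem hx hy
  · intro f hf
    refine ⟨TensorProduct.AlgebraTensorModule.map (fil hp i).subtype LinearMap.id
      (((⟨f, hf⟩ : fil hp i)) ⊗ₜ (1 : ℚ_[p])), ⟨_, rfl⟩, ?_⟩
    rw [LinearEquiv.coe_coe, TensorProduct.AlgebraTensorModule.map_tmul, Submodule.subtype_apply,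
      LinearMap.id_apply, ridHT_tmul, one_smul]

/-- `dim Fil^i D = dim (D ∩ Fil^i)` computed inside `B_HT`. [folklore] -/
theorem finrank_htFilD (i : ℤ) :
    Module.finrank F (htFilD hp i) = Module.finrank F ((Dtw hp ⊓ fil hp i : Submodule F (HT hp))) := by
  have hinj : Function.Injective (htRep hp).invariants.subtype := Subtype.val_injective
  rw [(Submodule.equivMapOfInjective _ hinj (htFilD hp i)).finrank_eq, htFilD, Submodule.map_comap_subtype,
    (Submodule.equivMapOfInjective ((ridHT hp) : HT hp ⊗[ℚ_[p]] ℚ_[p] →ₗ[F] HT hp) (ridHT hp).injective _).finrank_eq,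
    Submodule.map_inf _ (ridHT hp).injective, map_invariants_eq_Dtw, map_htFilTensor]

section Canonical

variable (halg : ∀ c : ℚ_[p], algebraMap ℚ_[p] F c = LocalField.padicRingHom F p hp c)
include halg

/-- **`dim_F Fil^i D_HT(ℚ_p(1)) = 1` for `i ≤ -1` and `0` for `i ≥ 0`** (`D = F T⁻¹`, `T⁻¹ ∈ Fil^i ↔ i ≤ -1`).
[cite: FontaineOuyang2022, §5.1] -/
theorem finrank_htFilD_eq (i : ℤ) : Module.finrank F (htFilD hp i) = if i ≤ -1 then 1 else 0 := by
  rw [finrank_htFilD, Dtw_eq_span hp halg]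
  split_ifs with hi
  · have hle : (F ∙ mono hp 1 (-1)) ≤ fil hp i := by
      rw [Submodule.span_le, Set.singleton_subset_iff]
      intro n hn
      rw [coeff_mono, if_neg (by omega)]
    rw [inf_eq_left.mpr hle]
    exact finrank_span_singleton (mono_ne_zero hp one_ne_zero (-1))
  · have hbot : (F ∙ mono hp 1 (-1)) ⊓ fil hp i = ⊥ := by
      rw [eq_bot_iff]
      rintro x ⟨hx1, hx2⟩
      rw [SetLike.mem_coe, Submodule.mem_span_singleton] at hx1
      obtain ⟨e, rfl⟩ := hx1
      have h1 : coeff hp (e • mono hp 1 (-1)) (-1) = 0 := hx2 (-1) (by omega)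
      rw [coeff_base_smul, coeff_mono, if_pos rfl, mul_one, map_eq_zero] at h1
      rw [Submodule.mem_bot, h1, zero_smul]
    rw [hbot, finrank_bot]

end Canonical

end HT

/-! ### The cyclotomic character is Hodge–Tate of weight `-1` (for `B_HT`) -/

omit [Algebra ℚ_[p] F] in
/-- **`ℚ_p(1)` is `B_HT`-admissible** (Hodge–Tate) for the canonical `ℚ_p`-structure on `F`:
`dim_F (B_HT ⊗ ℚ_p(1))^{Γ_F} = 1 = dim ℚ_p(1)`. [cite: FontaineOuyang2022, §5.1]
[cite: Tate1967, §3.3 Theorem 2] -/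
theorem isAdmissible_hodgeTate_cyclotomicRepQp :
    letI := LocalField.padicAlgebra F p hp
    (hodgeTatePeriodRingData hp).IsAdmissible (cyclotomicRepQp F p) := by
  letI := LocalField.padicAlgebra F p hp
  change Module.finrank F (HT.htRep hp).invariants = Module.finrank ℚ_[p] ℚ_[p]
  rw [HT.finrank_invariants hp (fun c => rfl), Module.finrank_self]

omit [Algebra ℚ_[p] F] in
/-- **The Hodge–Tate weight of the cyclotomic character is `-1`** (for `B_HT`, in the
convention of `PeriodRingData.hodgeTateWeights`: the multiset of jumps of `dim Fil^• D`).
[cite: FontaineOuyang2022, §5.1] [cite: Tate1967, §3.3 Theorem 2] -/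
theorem hodgeTateWeights_cyclotomicRepQp :
    letI := LocalField.padicAlgebra F p hp
    (hodgeTatePeriodRingData hp).hodgeTateWeights (cyclotomicRepQp F p) = {-1} := by
  letI := LocalField.padicAlgebra F p hp
  rw [PeriodRingData.hodgeTateWeights_eq_jumpMultiset]
  have hfr : (fun i => Module.finrank F ((hodgeTatePeriodRingData hp).filD (cyclotomicRepQp F p) i)) =
      fun i => if i ≤ -1 then 1 else 0 := by
    funext i
    change Module.finrank F (HT.htFilD hp i) = _
    exact HT.finrank_htFilD_eq hp (fun c => rfl) i
  rw [hfr, jumpMultiset_step]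
  rfl

end HodgeTateCyclotomic



end Literature.NumberTheory.PAdicHodge

end
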